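import Summits.QuantumAdvantage.QuantumAdvantage.Theorems.CubicForrelationNearExactIsExactRateStrict

/-!
# Crux `CubicForrelation.NearExactIsExact` (stmt-QuantumAdvantage-14043) — n = 6: `Φ ≥ 7/8 ⇒ Φ = 1` (`θ₆ < 7/8`), completing
  `θ_n < 1 − 2^{−⌊n/3⌋−1}` for EVERY even `n ≥ 6`

Certificate seat `b2b-cforr-cert` (gen 6).  HONEST FRAMING: a finite-slice verdict (`n = 6`) plus the repackaged union over all even `n ≥ 6`
(the exact range of the tree's one-sided `isolation_rate_even`); NOT summit progress.

On `6` bits `W_g = 4u` (Ax) with constant level parity; the two-sided budget is `Σ (u − 2s)² = 2⁹(1 − Φ) ≤ 64 = N` at `Φ ≥ 7/8`.  All `u`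
even: `g` is bent (`Φ = 1` or `≤ 3/4`) or capped (`Φ ≤ 3/4`).  All `u` odd (`six_side`): `τ = u − 2(−1)^f = ±1` everywhere — and BY SYMMETRY
(`Φ(g,f) = Φ(f,g)`) the same holds for `f`: `W_f = 4v`, `v − 2(−1)^g = ±1`.  Walsh inversion then computes `τ̂(y) = 16(−1)^{g(y)} − 8v(y) = ∓8`
for every `y`, so `Σ|τ̂| = 512`; but the general 3- and 4-flat sums make `τ` satisfy (H3)/(H4) on the whole space and the engine `fl1_flat_l1`
gives `(Σ|τ̂|)² ≤ 4·4⁶ = 2¹⁴ < 512²` (`six_isolation_ge`).  At `n = 6` the pairing identity alone is not enough (it gives `128 ≤ 128`); the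
symmetric use of the partner is what closes the case.  Corollaries: `isolation_six_closed` (type `Fin 6`), `theta_six_lt`, and
`isolation_rate_closed_all` / `theta_lt_rate_all` (every even `n ≥ 6`).

References: as in the imported files.  Everything below is proved from the tree; axioms are the standard three.
-/

set_option linter.dupNamespace false -- D-0017: single-problem summit ⇒ `QuantumAdvantage.QuantumAdvantage` by design

noncomputable section

namespace Summit.QuantumAdvantage.QuantumAdvantage.Theorems.CubicForrelation.NearExactIsExact

open Finset
open Literature.Computability.QuantumComplexity
open Literature.Computability.QuantumComplexity.BuzetChailloux (bxor zeroVec zeroVec_bxor)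
open Literature.Computability.QuantumComplexity.DerivativeWalsh (W)
open Summit.QuantumAdvantage.QuantumAdvantage.Theorems.SignedCubicForrelationNotPrBPP.Negative.HalfQuad (forrelation_comm)

/-- **One side on 6 bits.** For cubic `F, G : 𝔽₂⁶ → 𝔽₂` with `7/8 ≤ Φ(F,G) ≠ 1` and `W_G = 4u` (Ax): every `u(x) − 2(−1)^{F(x)}` is `±1`
(the level parity is constant; the even case is bent-or-capped, `Φ ∈ {1} ∪ [0, 3/4]`; the odd case spends the budget `2⁹(1−Φ) ≤ 64` exactly).
[this work] -/
theorem six_side (F G : (Fin (3 * 1 + 3 * 1) → Bool) → Bool) (hF : IsDegLeFun 3 F) (hG : IsDegLeFun 3 G)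
    (hΦ : (7 / 8 : ℝ) ≤ forrelation F G) (hne : forrelation F G ≠ 1)
    (u : (Fin (3 * 1 + 3 * 1) → Bool) → ℤ) (hu : ∀ x, W (fun y => signOf (G y)) x = (2 : ℝ) ^ (2 * 1) * (u x : ℝ)) :
    ∀ x, u x - 2 * sZ (F x) = 1 ∨ u x - 2 * sZ (F x) = -1 := by
  classical
  have hdeg := stub_walshTower stub_axParity (3 * 1 + 3 * 1) (2 * 1) 0 G u hG hu (by intro k hk hkn; omega)
  by_cases hodd : ∃ x, Odd (u x)
  · obtain ⟨x₀, hx₀⟩ := hodd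
    have hall : ∀ x, Odd (u x) := by
      intro x
      have hc := tc_const_of_deg_zero hdeg x x₀
      rw [decide_eq_true hx₀] at hc
      exact of_decide_eq_true hc
    have hbud := zms_budget 1 F G u hu
    have hTle : (∑ x, (u x - 2 ^ 1 * sZ (F x)) ^ 2 : ℤ) ≤ 64 := by
      have h1 : (2 : ℝ) ^ (8 * 1 + 1) * (1 - forrelation F G) ≤ 64 := by
        have h512 : (2 : ℝ) ^ (8 * 1 + 1) = 512 := by norm_num
        rw [h512]; linarith
      have h' : ((∑ x, (u x - 2 ^ 1 * sZ (F x)) ^ 2 : ℤ) : ℝ) ≤ 64 := by rw [hbud]; exact h1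
      exact_mod_cast h'
    have hnonneg : ∀ x, 0 ≤ (u x - 2 ^ 1 * sZ (F x)) ^ 2 - (1 : ℤ) := by
      intro x
      have hodd' : Odd (u x - 2 ^ 1 * sZ (F x)) := by
        have h2 : Even ((2 : ℤ) ^ 1 * sZ (F x)) := ⟨sZ (F x), by ring⟩
        exact Int.odd_sub.2 (iff_of_true (hall x) h2)
      have h0 := Int.odd_iff.1 hodd'
      have : u x - 2 ^ 1 * sZ (F x) ≤ -1 ∨ 1 ≤ u x - 2 ^ 1 * sZ (F x) := by omega
      have := tp_sq_ge (k := 1) (by norm_num) this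
      linarith
    have hcard : (Fintype.card (Fin (3 * 1 + 3 * 1) → Bool) : ℤ) = 64 := by
      rw [Fintype.card_fun, Fintype.card_bool, Fintype.card_fin]; norm_num
    have hsum0 : ∑ x, ((u x - 2 ^ 1 * sZ (F x)) ^ 2 - (1 : ℤ)) = 0 := by
      refine le_antisymm ?_ (sum_nonneg fun x _ => hnonneg x)
      rw [sum_sub_distrib, sum_const, card_univ, nsmul_eq_mul, hcard]
      linarith
    intro x
    have h := (sum_eq_zero_iff_of_nonneg fun y _ => hnonneg y).1 hsum0 x (mem_univ x)
    rw [pow_one] at h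
    have h1 : (u x - 2 * sZ (F x)) * (u x - 2 * sZ (F x)) = 1 := by rw [← pow_two]; linarith
    exact mul_self_eq_one_iff.1 h1
  · exfalso
    push Not at hodd
    have hu' := tw_level_up G u hu hodd
    rcases tms_walk_from (3 * 1) (2 * 1 + 1) 2 G hG (by norm_num) (by norm_num) _ hu' (by intro j hj hjm; omega) (by norm_num)
      with hbent | hcap
    · rcases tw_bent_end (by norm_num) F G hF hG hbent with h | h
      · exact hne h
      · have e : (2 : ℝ) / 2 ^ ((3 * 1 + 3) / 2) = 1 / 4 := by norm_num
        rw [e] at h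
        linarith
    · have h := tw_forrelation_le_of_cap F G hcap
      have e : ((1 : ℝ) / 2) ^ 2 = 1 / 4 := by norm_num
      rw [e] at h
      linarith

/-- **`Φ ≥ 7/8 ⇒ Φ = 1` for cubic pairs on `3 + 3` bits** (two-sided and symmetric, see the header). [this work] -/
theorem six_isolation_ge (f g : (Fin (3 * 1 + 3 * 1) → Bool) → Bool) (hf : IsDegLeFun 3 f) (hg : IsDegLeFun 3 g)
    (hΦ : (7 / 8 : ℝ) ≤ forrelation f g) : forrelation f g = 1 := by
  classical
  by_contra hne
  obtain ⟨u, hu⟩ := tw_base g hg (2 * 1) (by norm_num)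
  obtain ⟨v, hv⟩ := tw_base f hf (2 * 1) (by norm_num)
  have hΦ' : (7 / 8 : ℝ) ≤ forrelation g f := by rw [forrelation_comm]; exact hΦ
  have hne' : forrelation g f ≠ 1 := by rw [forrelation_comm]; exact hne
  have hτ := six_side f g hf hg hΦ hne u hu
  have hσ := six_side g f hg hf hΦ' hne' v hv
  -- (H3)/(H4) for `e = u − 2(−1)^f` on the whole space
  set e : (Fin (3 * 1 + 3 * 1) → Bool) → ℤ := fun x => u x - 2 * sZ (f x) with hedef
  have hS : (univ : Finset (Fin (3 * 1 + 3 * 1) → Bool)) = (univ : Finset (Fin (3 * 1 + 3 * 1) → Bool)).image (bxor zeroVec) := by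
    ext y
    simp only [mem_univ, mem_image, true_and, true_iff]
    exact ⟨y, zeroVec_bxor y⟩
  have H3 : ∀ x ∈ (univ : Finset (Fin (3 * 1 + 3 * 1) → Bool)), ∀ a b c : Fin (3 * 1 + 3 * 1) → Bool,
      a ∈ (univ : Finset _) → b ∈ (univ : Finset _) → c ∈ (univ : Finset _) →
      (4 : ℤ) ∣ ∑ ε : Fin 3 → Bool, e (fun j => x j ^^ decide (Odd #(univ.filter fun i =>
        ε i && (![a, b, c] : Fin 3 → Fin (3 * 1 + 3 * 1) → Bool) i j))) := by
    intro x _ a b c _ _ _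
    have h4 := fs_flat_sum_dvd (e := 2) g u hg hu x ![a, b, c] (by norm_num)
    obtain ⟨zf, hzf⟩ := sl_sum_sZ_flat f hf x ![a, b, c]
    have hzf' : ∑ ε : Fin 3 → Bool, 2 * sZ (f (fun j => x j ^^ decide (Odd #(univ.filter fun i =>
          ε i && (![a, b, c] : Fin 3 → Fin (3 * 1 + 3 * 1) → Bool) i j)))) = 4 * zf := by
      rw [← mul_sum, hzf, show (3 + 2) / 3 = 1 from rfl]; ring
    have h4n : (4 : ℤ) ∣ ∑ ε : Fin 3 → Bool, u (fun j => x j ^^ decide (Odd #(univ.filter fun i =>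
          ε i && (![a, b, c] : Fin 3 → Fin (3 * 1 + 3 * 1) → Bool) i j))) := by
      have e4 : (2 : ℤ) ^ 2 = 4 := by norm_num
      rw [e4] at h4; exact h4
    simp only [e]
    rw [sum_sub_distrib, hzf']
    exact dvd_sub h4n (Dvd.intro _ rfl)
  have H4 : ∀ x ∈ (univ : Finset (Fin (3 * 1 + 3 * 1) → Bool)), ∀ a₀ a₁ a₂ a₃ : Fin (3 * 1 + 3 * 1) → Bool,
      a₀ ∈ (univ : Finset _) → a₁ ∈ (univ : Finset _) → a₂ ∈ (univ : Finset _) → a₃ ∈ (univ : Finset _) →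
      (8 : ℤ) ∣ ∑ ε : Fin 4 → Bool, e (fun j => x j ^^ decide (Odd #(univ.filter fun i =>
        ε i && (![a₀, a₁, a₂, a₃] : Fin 4 → Fin (3 * 1 + 3 * 1) → Bool) i j))) := by
    intro x _ a₀ a₁ a₂ a₃ _ _ _ _
    have h8 := fs_flat_sum_dvd (e := 3) g u hg hu x ![a₀, a₁, a₂, a₃] (by norm_num)
    obtain ⟨zf, hzf⟩ := sl_sum_sZ_flat f hf x ![a₀, a₁, a₂, a₃]
    have hzf' : ∑ ε : Fin 4 → Bool, 2 * sZ (f (fun j => x j ^^ decide (Odd #(univ.filter fun i =>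
          ε i && (![a₀, a₁, a₂, a₃] : Fin 4 → Fin (3 * 1 + 3 * 1) → Bool) i j)))) = 8 * zf := by
      rw [← mul_sum, hzf, show (4 + 2) / 3 = 2 from rfl]; ring
    have h8n : (8 : ℤ) ∣ ∑ ε : Fin 4 → Bool, u (fun j => x j ^^ decide (Odd #(univ.filter fun i =>
          ε i && (![a₀, a₁, a₂, a₃] : Fin 4 → Fin (3 * 1 + 3 * 1) → Bool) i j))) := by
      have e8 : (2 : ℤ) ^ 3 = 8 := by norm_num
      rw [e8] at h8; exact h8
    simp only [e]
    rw [sum_sub_distrib, hzf']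
    exact dvd_sub h8n (Dvd.intro _ rfl)
  have hE := fl1_flat_l1 univ univ zeroVec (mem_univ _) (fun a _ b _ => mem_univ _) hS e (fun x _ => hτ x) H3 H4
  set A : (Fin (3 * 1 + 3 * 1) → Bool) → ℝ :=
    fun x => if x ∈ (univ : Finset (Fin (3 * 1 + 3 * 1) → Bool)) then (e x : ℝ) else 0 with hA
  -- Walsh inversion: `Â(y) = 16(−1)^{g(y)} − 8v(y) = ∓8`
  have hWA : ∀ y, W A y = 16 * signOf (g y) - 8 * (v y : ℝ) := by
    intro y
    have h0 : W A y = ∑ x, A x * twist x y := rfl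
    have h1 : ∀ x, A x * twist x y = (1 / 4) * (W (fun z => signOf (g z)) x * twist x y) - 2 * (signOf (f x) * twist x y) := by
      intro x
      simp only [A, if_pos (mem_univ x), e]
      push_cast
      rw [tp_sZ_cast, hu x]
      ring
    have h2 : ∑ x, signOf (f x) * twist x y = W (fun z => signOf (f z)) y := rfl
    rw [h0, sum_congr rfl fun x _ => h1 x, sum_sub_distrib, ← mul_sum, ← mul_sum, tz_inversion, h2, hv y]
    ring
  have habs : ∀ y, |W A y| = 8 := by
    intro y
    rw [hWA y, ← tp_sZ_cast]
    rcases hσ y with h | h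
    · have hv' : (v y : ℝ) = 2 * (sZ (g y) : ℝ) + 1 := by
        have : v y = 2 * sZ (g y) + 1 := by linarith
        exact_mod_cast this
      rw [hv']
      ring_nf
      norm_num
    · have hv' : (v y : ℝ) = 2 * (sZ (g y) : ℝ) - 1 := by
        have : v y = 2 * sZ (g y) - 1 := by linarith
        exact_mod_cast this
      rw [hv']
      ring_nf
      norm_num
  have hsum : ∑ y, |W A y| = 512 := by
    rw [sum_congr rfl fun y _ => habs y, sum_const, card_univ, Fintype.card_fun, Fintype.card_bool, Fintype.card_fin,
      nsmul_eq_mul]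
    norm_num
  rw [hsum] at hE
  norm_num at hE

/-- **On 6 bits, cubic pairs with `Φ ≥ 7/8` are exact** (type `Fin 6`): the boundary value `7/8` of the one-sided rate is not attained,
`θ₆ < 7/8`.  Finite-slice verdict; NOT summit progress. [this work] -/
theorem isolation_six_closed : ∀ f g : (Fin 6 → Bool) → Bool, IsDegLeFun 3 f → IsDegLeFun 3 g →
    (7 / 8 : ℝ) ≤ forrelation f g → forrelation f g = 1 :=
  fun f g hf hg hΦ => six_isolation_ge f g hf hg hΦ

/-- **`θ₆ < 7/8`.** NOT summit progress. [this work] -/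
theorem theta_six_lt : ∃ θ : ℝ, θ < 7 / 8 ∧ ∀ f g : (Fin 6 → Bool) → Bool, IsDegLeFun 3 f → IsDegLeFun 3 g →
    θ < forrelation f g → forrelation f g = 1 :=
  fb_theta_lt_of_closed (n := 6) _ isolation_six_closed

/-- **The uniform rate is strict on the whole range of `isolation_rate_even`.**  For every even `n ≥ 6` and all cubic `f, g : 𝔽₂ⁿ → 𝔽₂`:
`Φ(f,g) ≥ 1 − 2^{−(⌊n/3⌋+1)} ⇒ Φ(f,g) = 1`.  NOT summit progress (the constants tend to `1`). [this work] -/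
theorem isolation_rate_closed_all : ∀ n : ℕ, Even n → 6 ≤ n → ∀ f g : (Fin n → Bool) → Bool,
    IsDegLeFun 3 f → IsDegLeFun 3 g → 1 - (1 / 2 : ℝ) ^ (n / 3 + 1) ≤ forrelation f g → forrelation f g = 1 := by
  intro n he h6 f g hf hg hΦ
  by_cases h8 : 8 ≤ n
  · exact isolation_rate_closed n he h8 f g hf hg hΦ
  · obtain ⟨m, rfl⟩ := he
    obtain rfl : m = 3 := by omega
    have e : (1 : ℝ) - (1 / 2) ^ ((3 + 3) / 3 + 1) = 7 / 8 := by norm_num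
    rw [e] at hΦ
    exact six_isolation_ge f g hf hg hΦ

/-- **`θ_n < 1 − 2^{−(⌊n/3⌋+1)}` for every even `n ≥ 6`.** NOT summit progress. [this work] -/
theorem theta_lt_rate_all (n : ℕ) (he : Even n) (h6 : 6 ≤ n) :
    ∃ θ : ℝ, θ < 1 - (1 / 2 : ℝ) ^ (n / 3 + 1) ∧ ∀ f g : (Fin n → Bool) → Bool, IsDegLeFun 3 f → IsDegLeFun 3 g →
      θ < forrelation f g → forrelation f g = 1 :=
  fb_theta_lt_of_closed (n := n) _ (isolation_rate_closed_all n he h6)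

end Summit.QuantumAdvantage.QuantumAdvantage.Theorems.CubicForrelation.NearExactIsExact

end
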